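import Summits.NavierStokesRegularity.NavierStokesRegularity.Theorems.SqueezeCycleRecurrentLiouvilleSmallHullRemoval
import Summits.NavierStokesRegularity.NavierStokesRegularity.Theorems.RecurrentProfilesRecurrentReductionOrbit
import Literature.Analysis.FluidPDE.SelfSimilar
import HarnessLib

/-!
# Crux `RecurrentLiouville` (stmt-NavierStokesRegularity-1589), line `Sketch` v7 — the core of
# fast recurrence removal (tools; lead c9)

Theorems-only file (no definitions, no named facts).  The class: suitable weak solutions `(u, p)` of
Navier–Stokes (`ν = 1`, `f = 0`) on the backward slab `ℝ³ × ℝ₋` with weak gradient `G`,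
Albritton–Barker quantity `𝐈 ≤ M` and (where stated) the Type-I rate `‖u(t,x)‖ ≤ C/√(−t)`; the
scaling orbit `σ ↦ u_{e^σ}`, `u_c(t,x) = c u(c²t, cx)` (`nsRescale`); distances in `L³(Q(0,1))`.

* `frCore_fast_of_modulus` — **fast recurrence removal from a class-uniform orbit modulus**: IF the
  class `{𝐈 ≤ M}` has a uniform modulus of continuity of the scaling orbit at `σ = 0` in `L³(Q(0,1))`
  (skeleton stub S1 `stub_frOrbitModulus`, taken here as a hypothesis), THEN for every rate `C` there
  are `L, δ > 0` such that a class member with the rate whose orbit returns `δ`-close to it in every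
  log-scale window `[a, a + L]` is regular at the origin.  Proof: for every `σ'` pick a return
  `σ ∈ [σ' − L, σ']`; the orbit point `u_{e^σ}` is again a class member with the same `𝐈` and rate
  (`zoom_slabProfile`), so the modulus bounds `‖u_{e^{σ'}} − u_{e^σ}‖ = ‖(u_{e^σ})_{e^{σ'−σ}} − u_{e^σ}‖`;
  the triangle inequality puts the WHOLE orbit in the `δ_SHR`-ball about `u` and `smallHullRemoval`
  (p117043: openness of the Leray–Tsai rung) removes the singularity.
* `frCore_epoch_of_modulus_of_epochRemoval` — **epoch form**: IF moreover near-stationary epochs are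
  removable (skeleton stub S2 `stub_frEpochRemoval`, hypothesis), THEN returns with gaps `≤ L` are
  needed only throughout ONE epoch `[A, A + E]` of log-scales: the orbit point at the first return
  after `A + L` is then `θ`-stationary over `[0, W]`, hence regular, and regularity descends to `u`
  along the zoom (`isBackwardSingularPoint_zoom`).

Both are pure compositions; the skeleton instantiates them with the landed stubs.

## References

* D. Albritton, T. Barker, J. Math. Fluid Mech. 21 (2019), Lemma 2.2, Prop. 2.3, §3. [AlbrittonBarker2019]
* T.-P. Tsai, Arch. Rational Mech. Anal. 143 (1998), Thm 1. [Tsai1998]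
* D. Chae, J. Wolf, arXiv:1610.09464, Thm 1.3 (the periodic case: near-identity DSS). [ChaeWolf2017RemovingDSS]
-/

noncomputable section

-- the sub-problem namespace repeats the summit name (D-0017 layout `Summit.<S>.<P>.Theorems`)
set_option linter.dupNamespace false

namespace Summit.NavierStokesRegularity.NavierStokesRegularity.Theorems

open MeasureTheory Set Function Filter Topology TopologicalSpace Metric
open Literature.Analysis Literature.Analysis.FluidPDE
open scoped NNReal ENNReal

/-! ### Bookkeeping along the orbit -/

/-- Orbit points of a slab profile are measurable on the unit backward ball (indeed on every
`Q(0, R) ⊆ ℝ³ × ℝ₋`). [cite: AlbrittonBarker2019, §3] -/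
theorem frCore_aestronglyMeasurable_nsRescale {u : ℝ → EuclideanSpace ℝ (Fin 3) → EuclideanSpace ℝ (Fin 3)}
    {p : ℝ → EuclideanSpace ℝ (Fin 3) → ℝ}
    {G : ℝ → EuclideanSpace ℝ (Fin 3) → EuclideanSpace ℝ (Fin 3) →L[ℝ] EuclideanSpace ℝ (Fin 3)}
    (hsw : IsSuitableWeakSolutionOn (slab (EuclideanSpace ℝ (Fin 3)) (Iio 0) isOpen_Iio) 1 0 u p)
    (hwg : HasWeakSpatialGradientOn (slab (EuclideanSpace ℝ (Fin 3)) (Iio 0) isOpen_Iio) u G) {c : ℝ} (hc : 0 < c)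
    {R : ℝ} :
    AEStronglyMeasurable (uncurry (nsRescale c u))
      (volume.restrict (parabolicCylinder R (0 : ℝ × EuclideanSpace ℝ (Fin 3)))) := by
  rw [nsRescale_eq_zoom]
  exact (zoom_slabProfile hsw hwg hc).2.1.locallyIntegrableOn.aestronglyMeasurable.mono_measure
    (Measure.restrict_mono (parabolicCylinder_origin_subset_slab _) le_rfl)

/-- A slab profile is measurable on every backward ball about the origin. [cite: AlbrittonBarker2019, §3] -/
theorem frCore_aestronglyMeasurable {u : ℝ → EuclideanSpace ℝ (Fin 3) → EuclideanSpace ℝ (Fin 3)}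
    {G : ℝ → EuclideanSpace ℝ (Fin 3) → EuclideanSpace ℝ (Fin 3) →L[ℝ] EuclideanSpace ℝ (Fin 3)}
    (hwg : HasWeakSpatialGradientOn (slab (EuclideanSpace ℝ (Fin 3)) (Iio 0) isOpen_Iio) u G) {R : ℝ} :
    AEStronglyMeasurable (uncurry u) (volume.restrict (parabolicCylinder R (0 : ℝ × EuclideanSpace ℝ (Fin 3)))) :=
  hwg.locallyIntegrableOn.aestronglyMeasurable.mono_measure
    (Measure.restrict_mono (parabolicCylinder_origin_subset_slab _) le_rfl)

/-- **The group law along log-scales**: `(u_{e^σ})_{e^τ} = u_{e^{σ + τ}}`. [folklore] -/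
theorem frCore_nsRescale_exp_exp (u : ℝ → EuclideanSpace ℝ (Fin 3) → EuclideanSpace ℝ (Fin 3)) (σ τ : ℝ) :
    nsRescale (Real.exp τ) (nsRescale (Real.exp σ) u) = nsRescale (Real.exp (σ + τ)) u := by
  rw [Real.exp_add, nsRescale_mul]

/-! ### Fast recurrence removal from the modulus -/

/-- **Fast recurrence removal from a class-uniform orbit modulus.**  If the class
`{suitable weak on ℝ³ × ℝ₋, weak gradient, 𝐈 ≤ M}` has, for every `M < ⊤` and `ε > 0`, a uniform
`r > 0` with `‖u_{e^σ} − u‖_{L³(Q(0,1))} ≤ ε` for `|σ| ≤ r`, then for every rate `C` and `M < ⊤` there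
are `L > 0`, `δ > 0` such that a class member with the rate `C` whose scaling orbit returns `δ`-close
to it in `L³(Q(0,1))` in every log-scale window `[a, a + L]` is regular at the origin: the whole
orbit then stays in the `δ_SHR`-ball about `u` (return + modulus of the returned orbit point, which is
again a class member: `zoom_slabProfile`) and `smallHullRemoval` applies.
[cite: Tsai1998, Thm 1; AlbrittonBarker2019, Lemma 2.2, Prop. 2.3] -/
theorem frCore_fast_of_modulus
    (hmod : ∀ (M : ℝ≥0∞), M < ⊤ → ∀ ε : ℝ, 0 < ε → ∃ r : ℝ, 0 < r ∧
      ∀ (u : ℝ → EuclideanSpace ℝ (Fin 3) → EuclideanSpace ℝ (Fin 3))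
        (p : ℝ → EuclideanSpace ℝ (Fin 3) → ℝ)
        (G : ℝ → EuclideanSpace ℝ (Fin 3) → EuclideanSpace ℝ (Fin 3) →L[ℝ] EuclideanSpace ℝ (Fin 3)),
        IsSuitableWeakSolutionOn (slab (EuclideanSpace ℝ (Fin 3)) (Iio 0) isOpen_Iio) 1 0 u p →
        HasWeakSpatialGradientOn (slab (EuclideanSpace ℝ (Fin 3)) (Iio 0) isOpen_Iio) u G →
        typeIBound (Iio (0 : ℝ) ×ˢ univ) u p G ≤ M →
        ∀ σ : ℝ, |σ| ≤ r →
          eLpNorm (uncurry (nsRescale (Real.exp σ) u) - uncurry u) 3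
            (volume.restrict (parabolicCylinder 1 (0 : ℝ × EuclideanSpace ℝ (Fin 3)))) ≤ ENNReal.ofReal ε) :
    ∀ (C : ℝ) (M : ℝ≥0∞), M < ⊤ → ∃ L : ℝ, 0 < L ∧ ∃ δ : ℝ, 0 < δ ∧
      ∀ (u : ℝ → EuclideanSpace ℝ (Fin 3) → EuclideanSpace ℝ (Fin 3))
        (p : ℝ → EuclideanSpace ℝ (Fin 3) → ℝ)
        (G : ℝ → EuclideanSpace ℝ (Fin 3) → EuclideanSpace ℝ (Fin 3) →L[ℝ] EuclideanSpace ℝ (Fin 3)),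
        IsSuitableWeakSolutionOn (slab (EuclideanSpace ℝ (Fin 3)) (Iio 0) isOpen_Iio) 1 0 u p →
        HasWeakSpatialGradientOn (slab (EuclideanSpace ℝ (Fin 3)) (Iio 0) isOpen_Iio) u G →
        typeIBound (Iio (0 : ℝ) ×ˢ univ) u p G ≤ M →
        HasTypeITimeDecay C u →
        (∀ a : ℝ, ∃ σ ∈ Icc a (a + L),
          eLpNorm (uncurry (nsRescale (Real.exp σ) u) - uncurry u) 3
            (volume.restrict (parabolicCylinder 1 (0 : ℝ × EuclideanSpace ℝ (Fin 3)))) ≤ ENNReal.ofReal δ) →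
        ¬ IsBackwardSingularPoint u 0 := by
  intro C M hM
  obtain ⟨δ₀, hδ₀, hSHR⟩ := smallHullRemoval C M hM
  obtain ⟨r, hr, hmod'⟩ := hmod M hM (δ₀ / 2) (half_pos hδ₀)
  refine ⟨r, hr, δ₀ / 2, half_pos hδ₀, fun u p G hsw hwg hI hdec hret => ?_⟩
  refine hSHR u p G hsw hwg hI hdec fun σ' => ?_
  -- a return `σ ∈ [σ' - r, σ']`
  obtain ⟨σ, hσ, hσret⟩ := hret (σ' - r)
  have hc : 0 < Real.exp σ := Real.exp_pos σ
  -- the returned orbit point is a class member with the same `𝐈`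
  have hz := zoom_slabProfile hsw hwg hc
  have hsw' : IsSuitableWeakSolutionOn (slab (EuclideanSpace ℝ (Fin 3)) (Iio 0) isOpen_Iio) 1 0 (nsRescale (Real.exp σ) u)
      ((Real.exp σ) ^ 2 • stPull ((Real.exp σ) ^ 2) (Real.exp σ) (0 : ℝ) (0 : EuclideanSpace ℝ (Fin 3)) p) := by
    rw [nsRescale_eq_zoom]; exact hz.1
  have hwg' : HasWeakSpatialGradientOn (slab (EuclideanSpace ℝ (Fin 3)) (Iio 0) isOpen_Iio) (nsRescale (Real.exp σ) u)
      ((Real.exp σ) ^ 2 • stPull ((Real.exp σ) ^ 2) (Real.exp σ) (0 : ℝ) (0 : EuclideanSpace ℝ (Fin 3)) G) := by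
    rw [nsRescale_eq_zoom]; exact hz.2.1
  have hI' : typeIBound (Iio (0 : ℝ) ×ˢ univ) (nsRescale (Real.exp σ) u)
      ((Real.exp σ) ^ 2 • stPull ((Real.exp σ) ^ 2) (Real.exp σ) (0 : ℝ) (0 : EuclideanSpace ℝ (Fin 3)) p)
      ((Real.exp σ) ^ 2 • stPull ((Real.exp σ) ^ 2) (Real.exp σ) (0 : ℝ) (0 : EuclideanSpace ℝ (Fin 3)) G) ≤ M := by
    rw [nsRescale_eq_zoom, hz.2.2]; exact hI
  -- the modulus over the gap `σ' - σ ∈ [0, r]`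
  have hτ : |σ' - σ| ≤ r := by
    rw [abs_le]
    constructor <;> linarith [hσ.1, hσ.2]
  have hgap := hmod' _ _ _ hsw' hwg' hI' (σ' - σ) hτ
  rw [frCore_nsRescale_exp_exp, show σ + (σ' - σ) = σ' by ring] at hgap
  -- measurability on the unit ball
  have hm1 : AEStronglyMeasurable (uncurry (nsRescale (Real.exp σ') u))
      (volume.restrict (parabolicCylinder 1 (0 : ℝ × EuclideanSpace ℝ (Fin 3)))) :=
    frCore_aestronglyMeasurable_nsRescale hsw hwg (Real.exp_pos σ')
  have hm2 : AEStronglyMeasurable (uncurry (nsRescale (Real.exp σ) u))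
      (volume.restrict (parabolicCylinder 1 (0 : ℝ × EuclideanSpace ℝ (Fin 3)))) :=
    frCore_aestronglyMeasurable_nsRescale hsw hwg hc
  have hm3 : AEStronglyMeasurable (uncurry u) (volume.restrict (parabolicCylinder 1 (0 : ℝ × EuclideanSpace ℝ (Fin 3)))) :=
    frCore_aestronglyMeasurable hwg
  -- triangle inequality through the return
  calc eLpNorm (uncurry (nsRescale (Real.exp σ') u) - uncurry u) 3
        (volume.restrict (parabolicCylinder 1 (0 : ℝ × EuclideanSpace ℝ (Fin 3))))
      = eLpNorm ((uncurry (nsRescale (Real.exp σ') u) - uncurry (nsRescale (Real.exp σ) u)) +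
          (uncurry (nsRescale (Real.exp σ) u) - uncurry u)) 3
          (volume.restrict (parabolicCylinder 1 (0 : ℝ × EuclideanSpace ℝ (Fin 3)))) := by rw [sub_add_sub_cancel]
    _ ≤ eLpNorm (uncurry (nsRescale (Real.exp σ') u) - uncurry (nsRescale (Real.exp σ) u)) 3
          (volume.restrict (parabolicCylinder 1 (0 : ℝ × EuclideanSpace ℝ (Fin 3)))) +
        eLpNorm (uncurry (nsRescale (Real.exp σ) u) - uncurry u) 3
          (volume.restrict (parabolicCylinder 1 (0 : ℝ × EuclideanSpace ℝ (Fin 3)))) :=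
        eLpNorm_add_le (hm1.sub hm2) (hm2.sub hm3) (by norm_num)
    _ ≤ ENNReal.ofReal (δ₀ / 2) + ENNReal.ofReal (δ₀ / 2) := add_le_add hgap hσret
    _ = ENNReal.ofReal δ₀ := by
        rw [← ENNReal.ofReal_add (half_pos hδ₀).le (half_pos hδ₀).le, add_halves]

/-! ### The epoch form -/

/-- **Epoch form of fast recurrence removal (from the modulus and epoch removal).**  If the class has a
uniform orbit modulus (S1) and near-stationary epochs are removable (S2: `∃ W, θ > 0`, a class member
with the rate whose orbit stays `θ`-close to it in `L³(Q(0,1))` over the epoch `[0, W]` is regular),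
then for every `C` and `M < ⊤` there are `L > 0`, `E > 0`, `δ > 0` such that a class member with the
rate whose scaling orbit returns `δ`-close to it in `L³(Q(0,1))` within every window `[a, a + L]`,
for all `a` in ONE epoch `[A, A + E]`, is regular at the origin: with `σ₀` the return in
`[A + L, A + 2L]`, every `u_{e^{σ₀ + s}}`, `s ∈ [0, W]`, is within modulus + `δ` of a return, so the
orbit point `u_{e^{σ₀}}` (a class member with the same `𝐈` and rate) is `θ`-stationary over `[0, W]`,
hence regular, and so is `u` (`isBackwardSingularPoint_zoom`).
[cite: AlbrittonBarker2019, Prop. 2.3, §3] -/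
theorem frCore_epoch_of_modulus_of_epochRemoval
    (hmod : ∀ (M : ℝ≥0∞), M < ⊤ → ∀ ε : ℝ, 0 < ε → ∃ r : ℝ, 0 < r ∧
      ∀ (u : ℝ → EuclideanSpace ℝ (Fin 3) → EuclideanSpace ℝ (Fin 3))
        (p : ℝ → EuclideanSpace ℝ (Fin 3) → ℝ)
        (G : ℝ → EuclideanSpace ℝ (Fin 3) → EuclideanSpace ℝ (Fin 3) →L[ℝ] EuclideanSpace ℝ (Fin 3)),
        IsSuitableWeakSolutionOn (slab (EuclideanSpace ℝ (Fin 3)) (Iio 0) isOpen_Iio) 1 0 u p →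
        HasWeakSpatialGradientOn (slab (EuclideanSpace ℝ (Fin 3)) (Iio 0) isOpen_Iio) u G →
        typeIBound (Iio (0 : ℝ) ×ˢ univ) u p G ≤ M →
        ∀ σ : ℝ, |σ| ≤ r →
          eLpNorm (uncurry (nsRescale (Real.exp σ) u) - uncurry u) 3
            (volume.restrict (parabolicCylinder 1 (0 : ℝ × EuclideanSpace ℝ (Fin 3)))) ≤ ENNReal.ofReal ε)
    (hepoch : ∀ (C : ℝ) (M : ℝ≥0∞), M < ⊤ → ∃ W : ℝ, 0 < W ∧ ∃ θ : ℝ, 0 < θ ∧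
      ∀ (u : ℝ → EuclideanSpace ℝ (Fin 3) → EuclideanSpace ℝ (Fin 3))
        (p : ℝ → EuclideanSpace ℝ (Fin 3) → ℝ)
        (G : ℝ → EuclideanSpace ℝ (Fin 3) → EuclideanSpace ℝ (Fin 3) →L[ℝ] EuclideanSpace ℝ (Fin 3)),
        IsSuitableWeakSolutionOn (slab (EuclideanSpace ℝ (Fin 3)) (Iio 0) isOpen_Iio) 1 0 u p →
        HasWeakSpatialGradientOn (slab (EuclideanSpace ℝ (Fin 3)) (Iio 0) isOpen_Iio) u G →
        typeIBound (Iio (0 : ℝ) ×ˢ univ) u p G ≤ M →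
        HasTypeITimeDecay C u →
        (∀ s ∈ Icc (0 : ℝ) W,
          eLpNorm (uncurry (nsRescale (Real.exp s) u) - uncurry u) 3
            (volume.restrict (parabolicCylinder 1 (0 : ℝ × EuclideanSpace ℝ (Fin 3)))) ≤ ENNReal.ofReal θ) →
        ¬ IsBackwardSingularPoint u 0) :
    ∀ (C : ℝ) (M : ℝ≥0∞), M < ⊤ → ∃ L : ℝ, 0 < L ∧ ∃ E : ℝ, 0 < E ∧ ∃ δ : ℝ, 0 < δ ∧
      ∀ (u : ℝ → EuclideanSpace ℝ (Fin 3) → EuclideanSpace ℝ (Fin 3))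
        (p : ℝ → EuclideanSpace ℝ (Fin 3) → ℝ)
        (G : ℝ → EuclideanSpace ℝ (Fin 3) → EuclideanSpace ℝ (Fin 3) →L[ℝ] EuclideanSpace ℝ (Fin 3)),
        IsSuitableWeakSolutionOn (slab (EuclideanSpace ℝ (Fin 3)) (Iio 0) isOpen_Iio) 1 0 u p →
        HasWeakSpatialGradientOn (slab (EuclideanSpace ℝ (Fin 3)) (Iio 0) isOpen_Iio) u G →
        typeIBound (Iio (0 : ℝ) ×ˢ univ) u p G ≤ M →
        HasTypeITimeDecay C u →
        (∃ A : ℝ, ∀ a ∈ Icc A (A + E), ∃ σ ∈ Icc a (a + L),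
          eLpNorm (uncurry (nsRescale (Real.exp σ) u) - uncurry u) 3
            (volume.restrict (parabolicCylinder 1 (0 : ℝ × EuclideanSpace ℝ (Fin 3)))) ≤ ENNReal.ofReal δ) →
        ¬ IsBackwardSingularPoint u 0 := by
  intro C M hM
  obtain ⟨W, hW, θ, hθ, hrem⟩ := hepoch C M hM
  obtain ⟨r, hr, hmod'⟩ := hmod M hM (θ / 2) (half_pos hθ)
  refine ⟨r, hr, W + 2 * r, by positivity, θ / 4, by positivity,
    fun u p G hsw hwg hI hdec ⟨A, hret⟩ hsing => ?_⟩
  -- the base return `σ₀ ∈ [A + r, A + 2r]`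
  obtain ⟨σ₀, hσ₀, hσ₀ret⟩ := hret (A + r) ⟨by linarith, by linarith⟩
  have hc₀ : 0 < Real.exp σ₀ := Real.exp_pos σ₀
  -- class data of an orbit point
  have hcls : ∀ τ : ℝ,
      IsSuitableWeakSolutionOn (slab (EuclideanSpace ℝ (Fin 3)) (Iio 0) isOpen_Iio) 1 0 (nsRescale (Real.exp τ) u)
        ((Real.exp τ) ^ 2 • stPull ((Real.exp τ) ^ 2) (Real.exp τ) (0 : ℝ) (0 : EuclideanSpace ℝ (Fin 3)) p) ∧
      HasWeakSpatialGradientOn (slab (EuclideanSpace ℝ (Fin 3)) (Iio 0) isOpen_Iio) (nsRescale (Real.exp τ) u)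
        ((Real.exp τ) ^ 2 • stPull ((Real.exp τ) ^ 2) (Real.exp τ) (0 : ℝ) (0 : EuclideanSpace ℝ (Fin 3)) G) ∧
      typeIBound (Iio (0 : ℝ) ×ˢ univ) (nsRescale (Real.exp τ) u)
        ((Real.exp τ) ^ 2 • stPull ((Real.exp τ) ^ 2) (Real.exp τ) (0 : ℝ) (0 : EuclideanSpace ℝ (Fin 3)) p)
        ((Real.exp τ) ^ 2 • stPull ((Real.exp τ) ^ 2) (Real.exp τ) (0 : ℝ) (0 : EuclideanSpace ℝ (Fin 3)) G) ≤ M := by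
    intro τ
    have hz := zoom_slabProfile hsw hwg (Real.exp_pos τ)
    refine ⟨?_, ?_, ?_⟩
    · rw [nsRescale_eq_zoom]; exact hz.1
    · rw [nsRescale_eq_zoom]; exact hz.2.1
    · rw [nsRescale_eq_zoom, hz.2.2]; exact hI
  -- the orbit point `v = u_{e^{σ₀}}` is `θ`-stationary over `[0, W]`
  have hstat : ∀ s ∈ Icc (0 : ℝ) W,
      eLpNorm (uncurry (nsRescale (Real.exp s) (nsRescale (Real.exp σ₀) u)) -
        uncurry (nsRescale (Real.exp σ₀) u)) 3
        (volume.restrict (parabolicCylinder 1 (0 : ℝ × EuclideanSpace ℝ (Fin 3)))) ≤ ENNReal.ofReal θ := by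
    intro s hs
    -- a return `σ₁` within `r` below `σ₀ + s`
    have ha : σ₀ + s - r ∈ Icc A (A + (W + 2 * r)) :=
      ⟨by linarith [hσ₀.1, hs.1], by linarith [hσ₀.2, hs.2]⟩
    obtain ⟨σ₁, hσ₁, hσ₁ret⟩ := hret (σ₀ + s - r) ha
    have hτ : |σ₀ + s - σ₁| ≤ r := by
      rw [abs_le]
      constructor <;> linarith [hσ₁.1, hσ₁.2]
    have hgap := hmod' _ _ _ (hcls σ₁).1 (hcls σ₁).2.1 (hcls σ₁).2.2 (σ₀ + s - σ₁) hτ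
    rw [frCore_nsRescale_exp_exp, show σ₁ + (σ₀ + s - σ₁) = σ₀ + s by ring] at hgap
    rw [frCore_nsRescale_exp_exp]
    -- measurability
    have hm0 : AEStronglyMeasurable (uncurry (nsRescale (Real.exp (σ₀ + s)) u))
        (volume.restrict (parabolicCylinder 1 (0 : ℝ × EuclideanSpace ℝ (Fin 3)))) :=
      frCore_aestronglyMeasurable_nsRescale hsw hwg (Real.exp_pos _)
    have hm1 : AEStronglyMeasurable (uncurry (nsRescale (Real.exp σ₁) u))
        (volume.restrict (parabolicCylinder 1 (0 : ℝ × EuclideanSpace ℝ (Fin 3)))) :=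
      frCore_aestronglyMeasurable_nsRescale hsw hwg (Real.exp_pos _)
    have hm2 : AEStronglyMeasurable (uncurry (nsRescale (Real.exp σ₀) u))
        (volume.restrict (parabolicCylinder 1 (0 : ℝ × EuclideanSpace ℝ (Fin 3)))) :=
      frCore_aestronglyMeasurable_nsRescale hsw hwg hc₀
    have hm3 : AEStronglyMeasurable (uncurry u) (volume.restrict (parabolicCylinder 1 (0 : ℝ × EuclideanSpace ℝ (Fin 3)))) :=
      frCore_aestronglyMeasurable hwg
    have hθ2 : 0 ≤ θ / 2 := (half_pos hθ).le
    have hθ4 : 0 ≤ θ / 4 := by positivity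
    calc eLpNorm (uncurry (nsRescale (Real.exp (σ₀ + s)) u) - uncurry (nsRescale (Real.exp σ₀) u)) 3
          (volume.restrict (parabolicCylinder 1 (0 : ℝ × EuclideanSpace ℝ (Fin 3))))
        = eLpNorm (((uncurry (nsRescale (Real.exp (σ₀ + s)) u) - uncurry (nsRescale (Real.exp σ₁) u)) +
              (uncurry (nsRescale (Real.exp σ₁) u) - uncurry u)) -
            (uncurry (nsRescale (Real.exp σ₀) u) - uncurry u)) 3
            (volume.restrict (parabolicCylinder 1 (0 : ℝ × EuclideanSpace ℝ (Fin 3)))) := by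
          rw [sub_add_sub_cancel, sub_sub_sub_cancel_right]
      _ ≤ eLpNorm ((uncurry (nsRescale (Real.exp (σ₀ + s)) u) - uncurry (nsRescale (Real.exp σ₁) u)) +
              (uncurry (nsRescale (Real.exp σ₁) u) - uncurry u)) 3
            (volume.restrict (parabolicCylinder 1 (0 : ℝ × EuclideanSpace ℝ (Fin 3)))) +
          eLpNorm (uncurry (nsRescale (Real.exp σ₀) u) - uncurry u) 3
            (volume.restrict (parabolicCylinder 1 (0 : ℝ × EuclideanSpace ℝ (Fin 3)))) :=
          eLpNorm_sub_le ((hm0.sub hm1).add (hm1.sub hm3)) (hm2.sub hm3) (by norm_num)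
      _ ≤ (eLpNorm (uncurry (nsRescale (Real.exp (σ₀ + s)) u) - uncurry (nsRescale (Real.exp σ₁) u)) 3
              (volume.restrict (parabolicCylinder 1 (0 : ℝ × EuclideanSpace ℝ (Fin 3)))) +
            eLpNorm (uncurry (nsRescale (Real.exp σ₁) u) - uncurry u) 3
              (volume.restrict (parabolicCylinder 1 (0 : ℝ × EuclideanSpace ℝ (Fin 3))))) +
          eLpNorm (uncurry (nsRescale (Real.exp σ₀) u) - uncurry u) 3
            (volume.restrict (parabolicCylinder 1 (0 : ℝ × EuclideanSpace ℝ (Fin 3)))) :=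
          add_le_add (eLpNorm_add_le (hm0.sub hm1) (hm1.sub hm3) (by norm_num)) le_rfl
      _ ≤ (ENNReal.ofReal (θ / 2) + ENNReal.ofReal (θ / 4)) + ENNReal.ofReal (θ / 4) :=
          add_le_add (add_le_add hgap hσ₁ret) hσ₀ret
      _ = ENNReal.ofReal θ := by
          rw [← ENNReal.ofReal_add hθ2 hθ4, ← ENNReal.ofReal_add (by positivity) hθ4]
          congr 1
          ring
  -- epoch removal for the orbit point, then descend to `u`
  have hdec₀ : HasTypeITimeDecay C (nsRescale (Real.exp σ₀) u) := hdec.nsRescale hc₀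
  have hreg := hrem _ _ _ (hcls σ₀).1 (hcls σ₀).2.1 (hcls σ₀).2.2 hdec₀ hstat
  refine hreg ?_
  rw [nsRescale_eq_zoom]
  exact isBackwardSingularPoint_zoom hsing hc₀

/-! ### Registered tools stub -/

/-- **Registered tools stub** `stub_frCoreTools` (crux stmt-NavierStokesRegularity-1589, line Sketch
v7): fast recurrence removal from the class-uniform orbit modulus (S1 as hypothesis), and its epoch
form (S1 and S2 as hypotheses). [cite: AlbrittonBarker2019, Lemma 2.2, Prop. 2.3] -/
theorem stub_frCoreTools :
    ((∀ (M : ℝ≥0∞), M < ⊤ → ∀ ε : ℝ, 0 < ε → ∃ r : ℝ, 0 < r ∧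
      ∀ (u : ℝ → EuclideanSpace ℝ (Fin 3) → EuclideanSpace ℝ (Fin 3))
        (p : ℝ → EuclideanSpace ℝ (Fin 3) → ℝ)
        (G : ℝ → EuclideanSpace ℝ (Fin 3) → EuclideanSpace ℝ (Fin 3) →L[ℝ] EuclideanSpace ℝ (Fin 3)),
        IsSuitableWeakSolutionOn (slab (EuclideanSpace ℝ (Fin 3)) (Iio 0) isOpen_Iio) 1 0 u p →
        HasWeakSpatialGradientOn (slab (EuclideanSpace ℝ (Fin 3)) (Iio 0) isOpen_Iio) u G →
        typeIBound (Iio (0 : ℝ) ×ˢ univ) u p G ≤ M →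
        ∀ σ : ℝ, |σ| ≤ r →
          eLpNorm (uncurry (nsRescale (Real.exp σ) u) - uncurry u) 3
            (volume.restrict (parabolicCylinder 1 (0 : ℝ × EuclideanSpace ℝ (Fin 3)))) ≤
              ENNReal.ofReal ε) →
    ∀ (C : ℝ) (M : ℝ≥0∞), M < ⊤ → ∃ L : ℝ, 0 < L ∧ ∃ δ : ℝ, 0 < δ ∧
      ∀ (u : ℝ → EuclideanSpace ℝ (Fin 3) → EuclideanSpace ℝ (Fin 3))
        (p : ℝ → EuclideanSpace ℝ (Fin 3) → ℝ)
        (G : ℝ → EuclideanSpace ℝ (Fin 3) → EuclideanSpace ℝ (Fin 3) →L[ℝ] EuclideanSpace ℝ (Fin 3)),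
        IsSuitableWeakSolutionOn (slab (EuclideanSpace ℝ (Fin 3)) (Iio 0) isOpen_Iio) 1 0 u p →
        HasWeakSpatialGradientOn (slab (EuclideanSpace ℝ (Fin 3)) (Iio 0) isOpen_Iio) u G →
        typeIBound (Iio (0 : ℝ) ×ˢ univ) u p G ≤ M →
        HasTypeITimeDecay C u →
        (∀ a : ℝ, ∃ σ ∈ Icc a (a + L),
          eLpNorm (uncurry (nsRescale (Real.exp σ) u) - uncurry u) 3
            (volume.restrict (parabolicCylinder 1 (0 : ℝ × EuclideanSpace ℝ (Fin 3)))) ≤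
              ENNReal.ofReal δ) →
        ¬ IsBackwardSingularPoint u 0) ∧
    ((∀ (M : ℝ≥0∞), M < ⊤ → ∀ ε : ℝ, 0 < ε → ∃ r : ℝ, 0 < r ∧
      ∀ (u : ℝ → EuclideanSpace ℝ (Fin 3) → EuclideanSpace ℝ (Fin 3))
        (p : ℝ → EuclideanSpace ℝ (Fin 3) → ℝ)
        (G : ℝ → EuclideanSpace ℝ (Fin 3) → EuclideanSpace ℝ (Fin 3) →L[ℝ] EuclideanSpace ℝ (Fin 3)),
        IsSuitableWeakSolutionOn (slab (EuclideanSpace ℝ (Fin 3)) (Iio 0) isOpen_Iio) 1 0 u p →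
        HasWeakSpatialGradientOn (slab (EuclideanSpace ℝ (Fin 3)) (Iio 0) isOpen_Iio) u G →
        typeIBound (Iio (0 : ℝ) ×ˢ univ) u p G ≤ M →
        ∀ σ : ℝ, |σ| ≤ r →
          eLpNorm (uncurry (nsRescale (Real.exp σ) u) - uncurry u) 3
            (volume.restrict (parabolicCylinder 1 (0 : ℝ × EuclideanSpace ℝ (Fin 3)))) ≤
              ENNReal.ofReal ε) →
    (∀ (C : ℝ) (M : ℝ≥0∞), M < ⊤ → ∃ W : ℝ, 0 < W ∧ ∃ θ : ℝ, 0 < θ ∧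
      ∀ (u : ℝ → EuclideanSpace ℝ (Fin 3) → EuclideanSpace ℝ (Fin 3))
        (p : ℝ → EuclideanSpace ℝ (Fin 3) → ℝ)
        (G : ℝ → EuclideanSpace ℝ (Fin 3) → EuclideanSpace ℝ (Fin 3) →L[ℝ] EuclideanSpace ℝ (Fin 3)),
        IsSuitableWeakSolutionOn (slab (EuclideanSpace ℝ (Fin 3)) (Iio 0) isOpen_Iio) 1 0 u p →
        HasWeakSpatialGradientOn (slab (EuclideanSpace ℝ (Fin 3)) (Iio 0) isOpen_Iio) u G →
        typeIBound (Iio (0 : ℝ) ×ˢ univ) u p G ≤ M →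
        HasTypeITimeDecay C u →
        (∀ s ∈ Icc (0 : ℝ) W,
          eLpNorm (uncurry (nsRescale (Real.exp s) u) - uncurry u) 3
            (volume.restrict (parabolicCylinder 1 (0 : ℝ × EuclideanSpace ℝ (Fin 3)))) ≤
              ENNReal.ofReal θ) →
        ¬ IsBackwardSingularPoint u 0) →
    ∀ (C : ℝ) (M : ℝ≥0∞), M < ⊤ → ∃ L : ℝ, 0 < L ∧ ∃ E : ℝ, 0 < E ∧ ∃ δ : ℝ, 0 < δ ∧
      ∀ (u : ℝ → EuclideanSpace ℝ (Fin 3) → EuclideanSpace ℝ (Fin 3))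
        (p : ℝ → EuclideanSpace ℝ (Fin 3) → ℝ)
        (G : ℝ → EuclideanSpace ℝ (Fin 3) → EuclideanSpace ℝ (Fin 3) →L[ℝ] EuclideanSpace ℝ (Fin 3)),
        IsSuitableWeakSolutionOn (slab (EuclideanSpace ℝ (Fin 3)) (Iio 0) isOpen_Iio) 1 0 u p →
        HasWeakSpatialGradientOn (slab (EuclideanSpace ℝ (Fin 3)) (Iio 0) isOpen_Iio) u G →
        typeIBound (Iio (0 : ℝ) ×ˢ univ) u p G ≤ M →
        HasTypeITimeDecay C u →
        (∃ A : ℝ, ∀ a ∈ Icc A (A + E), ∃ σ ∈ Icc a (a + L),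
          eLpNorm (uncurry (nsRescale (Real.exp σ) u) - uncurry u) 3
            (volume.restrict (parabolicCylinder 1 (0 : ℝ × EuclideanSpace ℝ (Fin 3)))) ≤
              ENNReal.ofReal δ) →
        ¬ IsBackwardSingularPoint u 0) :=
  ⟨frCore_fast_of_modulus, frCore_epoch_of_modulus_of_epochRemoval⟩

end Summit.NavierStokesRegularity.NavierStokesRegularity.Theorems

end
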